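import Summits.QuantumFields.QCD.Theses.NestedDissectionSea
import Summits.QuantumFields.QCD.Theorems.HeatSlicedQuarksInterleavedFlowProperStubFormatHandover

/-!
# Crux `InterleavedFlowProper` (stmt-QuantumFields-18031), line `Sketch` — the rev-3 handover, part 2:
# the quantifier match `coerciveFormat_instantiate`

Registered stub of the skeleton `Cruxes/InterleavedFlowProper/Lines/Sketch.lean` (namespace
`Summit.QuantumFields.QCD.Cruxes.InterleavedFlowProper.OffsetLastFormatHandover`):

  `coerciveFormat_instantiate : RobustYangMillsRG → CoerciveFormatMembership → BlockGapAlongQCDWeight`.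

Part 1 (`…StubFormatHandover.lean`, p147381) landed the corrected milestone `CoerciveFormatMembership` (rev 3's
`let AdmAt` pasted verbatim at the all-axes-antiperiodic quark-integrated Wilson weight, with the lever's quantifier
order: format constants → `β₀` → `M₀, ℓ₀, reg` → mass tuple → `βe, Bl`) and the target `BlockGapAlongQCDWeight`
(rev 3's block-level clustering copied verbatim for the QCD weight with the SAME `βe, Bl`).  This file proves the
match: feed the seven format constants to the YM item, receive its `β₀`, choose `M₀, ℓ₀, reg` by the milestone AT that
`β₀`, and for each positive tuple hand the milestone's `βe, Bl` (convergent, eventually `β₀ ≤ βe k` and admissible on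
all `S ≥ reg.L k`) to the YM item with the scheme's own `a = reg.a`, `L = reg.L` (positivity and the two limits are
fields of `QCDRegularisation`); its conclusion is `BlockGapAlongQCDWeight`'s last conjunct literally, the physical-branch
clause `-1 < mass f k` riding along unchanged.

The YM-side decl is read through its `NestedDissectionSea` copy
(`Summit.QuantumFields.QCD.Theses.NestedDissectionSea.RobustYangMillsRG`, item stmt-QuantumFields-17812 — the decl
that item's own line lead works against; the `HeavyThresholdYMBridge` copy of the same item is textually identical).
No named facts; pure logic over the two pasted binders.
-/

namespace Summit.QuantumFields.QCD.Cruxes.InterleavedFlowProper.OffsetLastFormatHandover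

open Summit.QuantumFields.QCD.Theses

/-- **Quantifier match with rev 3 of the YM item** (registered stub `coerciveFormat_instantiate` of line `Sketch`):
the lever's order in `CoerciveFormatMembership` feeds `NestedDissectionSea.RobustYangMillsRG` (item
stmt-QuantumFields-17812, whose `let AdmAt` the milestone pastes verbatim) and returns its block-level clustering
for the QCD weight with the SAME witnesses `βe, Bl` — `BlockGapAlongQCDWeight`. -/
theorem coerciveFormat_instantiate :
    NestedDissectionSea.RobustYangMillsRG → CoerciveFormatMembership → BlockGapAlongQCDWeight := by
  intro hYM hfmt Nf hNf
  obtain ⟨ε, r, B₀, κ, c₀, cA, A₀, hε, hr, hB₀, hκ, hc₀, hcA, hA₀, hrest⟩ := hfmt Nf hNf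
  obtain ⟨β₀, _hβ₀, hYM'⟩ := hYM ε r B₀ κ c₀ cA A₀ hε hr hB₀ hκ hc₀ hcA hA₀
  obtain ⟨M₀, ℓ₀, hM₀, hℓ₀, reg, hms, has, hmr⟩ := hrest β₀
  refine ⟨ε, r, B₀, κ, c₀, cA, A₀, hε, hr, hB₀, hκ, hc₀, hcA, hA₀, β₀, M₀, ℓ₀, hM₀, hℓ₀, reg, hms, has,
    fun mr hmr' => ?_⟩
  obtain ⟨βe, Bl, hconv, hev⟩ := hmr mr hmr'
  refine ⟨βe, Bl, hconv, hev, ?_⟩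
  exact hYM' reg.a reg.L reg.a_pos reg.tendsto_a reg.tendsto_L ℓ₀ hℓ₀ _ βe Bl hconv
    (hev.mono fun k hk => ⟨hk.1, hk.2.2⟩)

end Summit.QuantumFields.QCD.Cruxes.InterleavedFlowProper.OffsetLastFormatHandover
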